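import Summits.QuantumAdvantage.QuantumAdvantage.Theorems.WalkThreeCharge

/-!
# Perfect strategies: `R5₀`, the TWISTED three-charge identity and the finite-state class FS2 (planner qa-qnc0-p2 g21,
# ROUND-21 (p2) §2 addendum + §6 (G)/(H); ask P2-21 (a) rev. 12:58Z; `--supports` crux `ManyReadersSqrtOdd` stmt-QuantumAdvantage-23109)

VERBATIM port (part 3/3, the tail added to `HOME/qa-qnc0-p2/line21/Sketch21.lean` after parts 1–2 = `WalkQuotient.lean`,
`WalkThreeCharge.lean` were landed; Sketch21 sha16 `9c26f2dc8ea8e9d6` at port time, lines 443–547; authored AND proved by the planner seat qn-p2 g21,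
farm rc 0 / 0 sorry; landed by qn-prover-3 g14; only this header is new).  Contents:

* `NoPerfectLinSel p` (rung R5₀: for large `n` no `LinSel p` strategy wins the u-walk game on every input) and
  `noPerfect_of_walkHardFLinSel : WalkHardFLinSel p → NoPerfectLinSel p`; `perfect_gives_avoidance` (a perfect strategy gives an exact
  MOD₃-avoiding statistic, from T′ `oddOneOutForm_holds`);
* **`twistedNotAllThree`** — the abstract twisted three-charge identity: labels `s g + k·t g` with `t g ≠ 0` cannot give an odd live
  count for all three `k` (each cut is dead for exactly one `k`; `sum_shift_ne_zero`);
* the 2-step FINITE-STATE class `FinState2 p y` (every cut's test factors through `(wtPrefix u g mod p, wt u mod p)`), the rung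
  `TwoStepFiniteStateWalkHard p` (§6 (G), statement only), the support statement `NoPerfectFinState2 p n₀` (§6 (H), statement only;
  sharp `n₀ = 12` for `p = 5` by the planner's exact computation) and `noPerfectFinState2_of_walkHard` (the rung with `ε < 1/3` gives it).

WHAT THIS IS NOT: instrument / statements for the DRAFT odd-prime routes (crux R5 `WalkHardFLinSel`, items 23109 / 23029); nothing here
bounds a polynomial strategy class; separation NOT moved.
-/

open Finset

namespace Summit.QuantumAdvantage.AdviceFreeQNC0

namespace Coset21

/-! #### Perfect strategies (ROUND-21 §2 addendum): `R5₀` and exact MOD₃-avoidance -/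

/-- **R5₀ `NoPerfectLinSel p`** (rung, implied by R5, marginally weaker): for large `n` no linear-test strategy wins the u-walk game on
EVERY input.  Data (kit j306093/j306518): a perfect strategy EXISTS at `p = 5, n = 8, c = 0`. -/
def NoPerfectLinSel (p : ℕ) [Fact p.Prime] : Prop :=
  ∃ n₀ : ℕ, ∀ n ≥ n₀, ∀ c : ℕ, ∀ y : Fin (n + 1) → (Fin n → Bool) → Bool, LinSel p y → ∃ u, ringWinU c y u = false

/-- R5 ⟹ R5₀. -/
theorem noPerfect_of_walkHardFLinSel (p : ℕ) [Fact p.Prime] (h : WalkHardFLinSel p) : NoPerfectLinSel p := by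
  obtain ⟨θ, hθ, n₀, hn⟩ := h
  refine ⟨n₀, fun n hn' c y hy => ?_⟩
  have hb := hn n hn' c y hy
  by_contra hne
  push Not at hne
  have hall : (univ.filter fun u : Fin n → Bool => ringWinU c y u = true) = univ := by
    apply Finset.filter_true_of_mem
    intro u _
    cases hu : ringWinU c y u
    · exact absurd hu (hne u)
    · rfl
  rw [hall, Finset.card_univ] at hb
  have hcard : (Fintype.card (Fin n → Bool) : ℝ) = (2 : ℝ) ^ n := by simp
  rw [hcard] at hb
  have hpos : (0 : ℝ) < (2 : ℝ) ^ n := by positivity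
  nlinarith

/-- A perfect strategy yields an EXACT MOD₃-AVOIDING statistic: `ψ(u) := −c − b*₀(u)` never equals `wt u (mod 3)` (from T′). -/
theorem perfect_gives_avoidance (n c : ℕ) (y : Fin (n + 1) → (Fin n → Bool) → Bool)
    (hperf : ∀ u, ringWinU c y u = true) : ∀ u : Fin n → Bool, (wt u + c + oddOneOut y u) % 3 ≠ 0 :=
  fun u => ((oddOneOutForm_holds n c y u).mp (hperf u)).2

/-! #### Twisted three-charge identity and the finite-state rung (ROUND-21 §6 (G)) -/

/-- Pointwise count: for `t ≠ 0` in `ZMod 3`, exactly two of the three values `s + k*t` are nonzero. -/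
theorem sum_shift_ne_zero (s t : ZMod 3) (ht : t ≠ 0) :
    (Finset.univ.sum fun k : ZMod 3 => if s + k * t ≠ 0 then 1 else 0) = 2 := by
  revert s t
  decide

/-- **Twisted three-charge identity** (abstract form).  If every cut `g` of a fired set `F` carries a walk label `s g : ZMod 3` and the
three variants of the input shift that label by `k * t g` with `t g ≠ 0` (equal shifts `t ≡ 1` = the three charges; shifts `(t, −t)` =
the window modification of §6 (G)), then the number of live cuts cannot be odd in all three variants: each cut is dead in exactly one. -/
theorem twistedNotAllThree {α : Type*} [DecidableEq α] (F : Finset α) (s t : α → ZMod 3) (ht : ∀ g ∈ F, t g ≠ 0) :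
    ¬ (∀ k : ZMod 3, Odd ((F.filter fun g => s g + k * t g ≠ 0).card)) := by
  intro hodd
  have hsum : (Finset.univ.sum fun k : ZMod 3 => (F.filter fun g => s g + k * t g ≠ 0).card) = 2 * F.card := by
    simp_rw [Finset.card_filter]
    rw [Finset.sum_comm]
    rw [Finset.sum_congr rfl fun g hg => sum_shift_ne_zero (s g) (t g) (ht g hg)]
    simp [mul_comm]
  have h3 : (Finset.univ.sum fun k : ZMod 3 => (F.filter fun g => s g + k * t g ≠ 0).card)
      = (F.filter fun g => s g + 0 * t g ≠ 0).card + (F.filter fun g => s g + 1 * t g ≠ 0).card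
        + (F.filter fun g => s g + 2 * t g ≠ 0).card :=
    Fin.sum_univ_three (fun k : ZMod 3 => (F.filter fun g => s g + k * t g ≠ 0).card)
  have hodd3 : Odd (2 * F.card) := by
    rw [← hsum, h3]
    exact Even.add_odd (Odd.add_odd (hodd 0) (hodd 1)) (hodd 2)
  exact (Nat.not_even_iff_odd.mpr hodd3) (even_two_mul F.card)

/-- The 2-step FINITE-STATE class FS2(p): every cut's test factors through `(wtPrefix u g mod p, wt u mod p)` via an arbitrary table.
Contains counters, counter-tables, prefix/suffix tables and the kill-test families F2 / F2-TABLES; every cut reads every bit (dense). -/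
def FinState2 (p : ℕ) {n : ℕ} (y : Fin (n + 1) → (Fin n → Bool) → Bool) : Prop :=
  ∃ T : Fin (n + 1) → ZMod p → ZMod p → Bool,
    ∀ g u, y g u = T g ((wtPrefix u g.val : ℕ) : ZMod p) ((wt u : ℕ) : ZMod p)

/-- **Rung `TwoStepFiniteStateWalkHard p`** (ROUND-21 §6 (G); candidate SUPPORT item, proof sketch complete: window + twisted three-charge
identity in the sparse-active regime, finite-state parity contraction ‖P D P‖ < 1 in the dense-active regime): finite-state 2-step
strategies win the u-walk game with probability at most `2/3 + ε` for large `n`.  Strictly between M19 (counters) and R5 (`LinSel`). -/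
def TwoStepFiniteStateWalkHard (p : ℕ) : Prop :=
  ∀ ε : ℝ, 0 < ε → ∃ n₀ : ℕ, ∀ n ≥ n₀, ∀ c : ℕ, ∀ y : Fin (n + 1) → (Fin n → Bool) → Bool, FinState2 p y →
    ((univ.filter fun u : Fin n → Bool => ringWinU c y u = true).card : ℝ) ≤ (2 / 3 + ε) * (2 : ℝ) ^ n

/-- **`NoPerfectFinState2 p n₀`** (ROUND-21 §6 (H); candidate SUPPORT item, SHARP `n₀ = 12` for `p = 5`, `16` for `p = 7`): no
finite-state 2-step strategy wins the u-walk game on every input once `n ≥ n₀`.  Proof route: weight classes are connected under adjacent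
transpositions, each moving a single prefix count, so perfection ⇔ per-cut constancy on reachable prefix intervals + a subset-XOR condition
(decidable, classes mod `p` decouple; `decide` for `12 ≤ n ≤ 37`), and for `n ≥ 38` middle cuts are forced OFF and the middle bits move
`wt u (mod 3)` freely under fixed end-cut data, so `twistedNotAllThree` applies. -/
def NoPerfectFinState2 (p n₀ : ℕ) : Prop :=
  ∀ n ≥ n₀, ∀ c : ℕ, ∀ y : Fin (n + 1) → (Fin n → Bool) → Bool, FinState2 p y → ∃ u, ringWinU c y u = false

/-- The finite-state case of `NoPerfectLinSel`-type statements follows from the rung with any `ε < 1/3`. -/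
theorem noPerfectFinState2_of_walkHard (p : ℕ) (h : TwoStepFiniteStateWalkHard p) : ∃ n₀, NoPerfectFinState2 p n₀ := by
  obtain ⟨n₀, hn₀⟩ := h (1 / 6) (by norm_num)
  refine ⟨n₀, fun n hn c y hy => ?_⟩
  have hb := hn₀ n hn c y hy
  by_contra hcon
  push Not at hcon
  have hall : (univ.filter fun u : Fin n → Bool => ringWinU c y u = true) = univ := by
    apply Finset.filter_true_of_mem
    intro u _
    cases hu : ringWinU c y u
    · exact absurd hu (hcon u)
    · rfl
  rw [hall, Finset.card_univ, Fintype.card_fun, Fintype.card_bool, Fintype.card_fin] at hb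
  have h2 : (0 : ℝ) < (2 : ℝ) ^ n := by positivity
  push_cast at hb
  nlinarith

end Coset21

end Summit.QuantumAdvantage.AdviceFreeQNC0
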